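import Summits.Ventures.HodgeRepro2.T5SU11LegendreSecondKindODE
import Summits.Ventures.HodgeRepro2.T5SU11LegendreSecondKindSeries
import Summits.Ventures.HodgeRepro2.T5SU11LegendreTuran
import Mathlib.Analysis.Polynomial.Basic

/-!
# The Wronskian of `P_n` and `Q_n`: `P_n Q′_n − P′_n Q_n = 1/(1 − x²)` on `(1, ∞)`; `Q′_n < 0` and `Q_n` decreasing

The series of the derivative, `Q′_n(x) = −Σ_k ½ (k + 1) x^{−(k+2)} ∫ t^k P_n` (`hasSum_legQ2'`, from
`1/(x − t)² = Σ_k (k + 1) t^k/x^{k+2}`), gives **`Q′_n(x) < 0` for `x > 1`** (`legQ2'_neg`), so `Q_n` is STRICTLY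
DECREASING on `(1, ∞)` (`strictAntiOn_legQ2`), and the asymptotic **`x^{n+2} Q′_n(x) → −(n + 1)/((2n + 1) lc_n)`**
(`tendsto_pow_mul_legQ2'`). For the Wronskian `W = P_n Q′_n − P′_n Q_n` the two Legendre equations (rows 399 and
435) give `((1 − x²) W)′ = 0` on `(1, ∞)` (`hasDerivAt_one_sub_sq_mul_wronskian`), so `(1 − x²) W` is constant
there (`one_sub_sq_mul_wronskian_eq`), and the asymptotics of `P_n`, `P′_n`, `Q_n`, `Q′_n` evaluate the constant:
`(1 − x²) W(x) → lc_n · (n + 1) c_n + n lc_n · c_n = (2n + 1) lc_n c_n = 1`. Hence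

  **`P_n(x) Q′_n(x) − P′_n(x) Q_n(x) = 1/(1 − x²)` for every `x > 1`**   (`wronskian_eq`):

`P_n` and `Q_n` are linearly independent solutions of Legendre's equation with the classical Wronskian. Nothing
is claimed about (N).

Blind lane: Mathlib + the HodgeRepro2 prefix only; no sorry; axioms ⊆ {propext, Classical.choice,
Quot.sound}.
-/

namespace Summit.Ventures.HodgeRepro2.T5SU11LegendreWronskian

open Polynomial intervalIntegral Finset Filter Topology MeasureTheory
open Set (Icc Ioi Ioo uIcc uIoc)
open T5SU11SphericalLegendreAll T5SU11JacobiPhaseLawEven T5SU11JacobiLegendreLeading T5SU11LegendreIdentities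
  T5SU11LegendreBound T5SU11LegendreTuran T5SU11LegendreZeros T5SU11LegendreSecondKind
  T5SU11LegendreSecondKindODE T5SU11LegendreMoments T5SU11LegendreSecondKindSeries

/-! ### The series of `Q′_n` -/

/-- **`1/(x − t)² = Σ_k (k + 1) t^k/x^{k+2}`** for `|t| < x`. -/
theorem hasSum_kernel_sq {x t : ℝ} (h : |t| < x) :
    HasSum (fun k : ℕ => ((k : ℝ) + 1) * t ^ k / x ^ (k + 2)) (1 / (x - t) ^ 2) := by
  have hx : 0 < x := lt_of_le_of_lt (abs_nonneg t) h
  have hr : ‖t / x‖ < 1 := by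
    rw [Real.norm_eq_abs, abs_div, abs_of_pos hx, div_lt_one hx]
    exact h
  have hxt : x - t ≠ 0 := by
    have := (abs_lt.mp h).2
    linarith
  -- `Σ (k + 1) r^k = Σ k r^k + Σ r^k = r/(1 − r)² + 1/(1 − r) = 1/(1 − r)²`
  have h1 := hasSum_coe_mul_geometric_of_norm_lt_one hr
  have h2 := hasSum_geometric_of_norm_lt_one hr
  have h3 := (h1.add h2).mul_left (1 / x ^ 2)
  have e : ∀ k : ℕ, 1 / x ^ 2 * ((k : ℝ) * (t / x) ^ k + (t / x) ^ k) = ((k : ℝ) + 1) * t ^ k / x ^ (k + 2) :=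
    fun k => by
      rw [div_pow, pow_add]
      field_simp
  have e2 : 1 / x ^ 2 * (t / x / (1 - t / x) ^ 2 + (1 - t / x)⁻¹) = 1 / (x - t) ^ 2 := by
    have h1x : 1 - t / x ≠ 0 := by
      intro h0
      rw [sub_eq_zero, eq_comm, div_eq_one_iff_eq hx.ne'] at h0
      exact hxt (by rw [h0, sub_self])
    field_simp
    ring
  simp_rw [e] at h3
  rwa [e2] at h3

/-- **The series of `Q′_n`**: `Q′_n(x) = Σ_k −½ (k + 1) x^{−(k+2)} ∫ t^k P_n` for `x > 1`. -/
theorem hasSum_legQ2' (n : ℕ) {x : ℝ} (hx : 1 < x) :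
    HasSum (fun k : ℕ => -(1 / 2) * (((k : ℝ) + 1) / x ^ (k + 2)) * ∫ t in (-1 : ℝ)..1, t ^ k * legP n t)
      (legQ2' n x) := by
  have hxpos : 0 < x := by linarith
  have hsub : uIoc (-1 : ℝ) 1 ⊆ Icc (-1 : ℝ) 1 := by
    rw [Set.uIoc_of_le (by norm_num)]
    exact Set.Ioc_subset_Icc_self
  have hmaj : Summable (fun k : ℕ => ((k : ℝ) + 1) / x ^ (k + 2)) := by
    have hr : ‖1 / x‖ < 1 := by
      rw [Real.norm_eq_abs, abs_of_pos (by positivity), div_lt_one hxpos]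
      exact hx
    have := ((hasSum_coe_mul_geometric_of_norm_lt_one hr).add (hasSum_geometric_of_norm_lt_one hr)).summable
      |>.mul_left (1 / x ^ 2)
    refine this.congr fun k => ?_
    rw [div_pow, one_pow, pow_add]
    field_simp
  have h := intervalIntegral.hasSum_integral_of_dominated_convergence (μ := volume) (a := (-1 : ℝ)) (b := 1)
    (F := fun (k : ℕ) (t : ℝ) => ((k : ℝ) + 1) * t ^ k / x ^ (k + 2) * legP n t)
    (f := fun t => legP n t / (x - t) ^ 2)
    (fun (k : ℕ) (_ : ℝ) => ((k : ℝ) + 1) / x ^ (k + 2))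
    (fun k => (((continuous_const.mul (continuous_pow k)).div_const _).mul (continuous_legP n)).aestronglyMeasurable)
    (fun k => Filter.Eventually.of_forall fun t ht => by
      have ht' : t ∈ Icc (-1 : ℝ) 1 := hsub ht
      have htabs : |t| ≤ 1 := abs_le.mpr ⟨ht'.1, ht'.2⟩
      rw [Real.norm_eq_abs, abs_mul, abs_div, abs_mul, abs_pow, abs_of_pos (pow_pos hxpos _),
        abs_of_pos (by positivity : (0 : ℝ) < (k : ℝ) + 1)]
      calc ((k : ℝ) + 1) * |t| ^ k / x ^ (k + 2) * |legP n t| ≤ ((k : ℝ) + 1) * 1 ^ k / x ^ (k + 2) * 1 := by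
            gcongr
            · exact abs_legP_le_one n ht'
        _ = ((k : ℝ) + 1) / x ^ (k + 2) := by rw [one_pow, mul_one, mul_one])
    (Filter.Eventually.of_forall fun _ _ => hmaj)
    intervalIntegrable_const
    (Filter.Eventually.of_forall fun t ht => by
      have ht' : t ∈ Icc (-1 : ℝ) 1 := hsub ht
      have htabs : |t| < x := lt_of_le_of_lt (abs_le.mpr ⟨ht'.1, ht'.2⟩) hx
      have := (hasSum_kernel_sq htabs).mul_right (legP n t)
      have e : 1 / (x - t) ^ 2 * legP n t = legP n t / (x - t) ^ 2 := by ring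
      rw [e] at this
      exact this)
  have h2 := h.mul_left (-(1 / 2))
  unfold legQ2'
  refine h2.congr_fun fun k => ?_
  rw [← intervalIntegral.integral_const_mul, ← intervalIntegral.integral_const_mul]
  exact integral_congr fun t _ => by ring

/-- Every term of the series of `Q′_n` is non-positive (`x > 1`). -/
theorem term_nonpos (n : ℕ) {x : ℝ} (hx : 1 < x) (k : ℕ) :
    -(1 / 2) * (((k : ℝ) + 1) / x ^ (k + 2)) * ∫ t in (-1 : ℝ)..1, t ^ k * legP n t ≤ 0 := by
  have hxpos : 0 < x := by linarith
  rcases Nat.lt_or_ge k n with hk | hk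
  · rw [integral_pow_mul_legP_eq_zero_of_lt hk, mul_zero]
  · have := integral_pow_mul_legP_nonneg hk
    have : 0 ≤ (1 / 2) * (((k : ℝ) + 1) / x ^ (k + 2)) * ∫ t in (-1 : ℝ)..1, t ^ k * legP n t := by positivity
    linarith

/-- **`Q′_n(x) < 0` for every `x > 1`.** -/
theorem legQ2'_neg (n : ℕ) {x : ℝ} (hx : 1 < x) : legQ2' n x < 0 := by
  have hxpos : 0 < x := by linarith
  have hL := legLead_pos n
  have hterm : -(1 / 2) * (((n : ℝ) + 1) / x ^ (n + 2)) * ∫ t in (-1 : ℝ)..1, t ^ n * legP n t < 0 := by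
    rw [integral_pow_self_mul_legP]
    have : 0 < (1 / 2) * (((n : ℝ) + 1) / x ^ (n + 2)) * (2 / ((2 * (n : ℝ) + 1) * legLead n)) := by positivity
    linarith
  -- `Q′_n ≤ the n-th term < 0`: use `−Q′_n = Σ (−term) ≥ −term_n > 0`
  have hneg := (hasSum_legQ2' n hx).neg
  have hle := le_hasSum hneg n fun j _ => by
    have := term_nonpos n hx j
    linarith
  linarith

/-- **`Q_n` is strictly decreasing on `(1, ∞)`.** -/
theorem strictAntiOn_legQ2 (n : ℕ) : StrictAntiOn (legQ2 n) (Ioi 1) := by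
  refine strictAntiOn_of_deriv_neg (convex_Ioi 1) ?_ fun x hx => ?_
  · exact fun x hx => (hasDerivAt_legQ2 n hx.out).continuousAt.continuousWithinAt
  · rw [interior_Ioi] at hx
    rw [(hasDerivAt_legQ2 n hx.out).deriv]
    exact legQ2'_neg n hx.out

/-! ### The asymptotic of `Q′_n` -/

/-- The terms with `k < n` vanish: `Q′_n(x) = Σ_j −½ (n + j + 1) x^{−(n+j+2)} ∫ t^{n+j} P_n`. -/
theorem hasSum_legQ2'_shift (n : ℕ) {x : ℝ} (hx : 1 < x) :
    HasSum (fun j : ℕ => -(1 / 2) * ((((j + n : ℕ) : ℝ) + 1) / x ^ (j + n + 2))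
      * ∫ t in (-1 : ℝ)..1, t ^ (j + n) * legP n t) (legQ2' n x) := by
  have h := hasSum_legQ2' n hx
  have h0 : ∑ k ∈ range n, -(1 / 2) * (((k : ℝ) + 1) / x ^ (k + 2)) * ∫ t in (-1 : ℝ)..1, t ^ k * legP n t = 0 :=
    Finset.sum_eq_zero fun k hk => by
      rw [integral_pow_mul_legP_eq_zero_of_lt (Finset.mem_range.mp hk), mul_zero]
  have := (hasSum_nat_add_iff' n).mpr h
  rw [h0, sub_zero] at this
  exact this.congr_fun fun j => rfl

/-- `Σ_{j≥0} (j + 1) x^{−(j+1)} = x/(x − 1)²` for `x > 1`. -/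
theorem hasSum_succ_mul_inv_pow {x : ℝ} (hx : 1 < x) :
    HasSum (fun j : ℕ => ((j : ℝ) + 1) / x ^ (j + 1)) (x / (x - 1) ^ 2) := by
  have hxpos : 0 < x := by linarith
  have hr : ‖1 / x‖ < 1 := by
    rw [Real.norm_eq_abs, abs_of_pos (by positivity), div_lt_one hxpos]
    exact hx
  have h := ((hasSum_coe_mul_geometric_of_norm_lt_one hr).add (hasSum_geometric_of_norm_lt_one hr)).mul_left (1 / x)
  have e : ∀ j : ℕ, 1 / x * ((j : ℝ) * (1 / x) ^ j + (1 / x) ^ j) = ((j : ℝ) + 1) / x ^ (j + 1) := fun j => by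
    rw [div_pow, one_pow, pow_succ]
    field_simp
  have e2 : 1 / x * (1 / x / (1 - 1 / x) ^ 2 + (1 - 1 / x)⁻¹) = x / (x - 1) ^ 2 := by
    have : x - 1 ≠ 0 := by linarith
    have h1x : 1 - 1 / x ≠ 0 := by
      intro h0
      rw [sub_eq_zero, eq_comm, div_eq_one_iff_eq hxpos.ne'] at h0
      exact hx.ne' h0.symm
    field_simp
    ring
  simp_rw [e] at h
  rwa [e2] at h

/-- **`|x^{n+2} Q′_n(x) + (n + 1)/((2n + 1) lc_n)| ≤ (n + 2) x/(x − 1)²`** for `x > 1`. -/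
theorem abs_pow_mul_legQ2'_add_le (n : ℕ) {x : ℝ} (hx : 1 < x) :
    |x ^ (n + 2) * legQ2' n x + ((n : ℝ) + 1) / ((2 * (n : ℝ) + 1) * legLead n)|
      ≤ ((n : ℝ) + 2) * (x / (x - 1) ^ 2) := by
  have hxpos : 0 < x := by linarith
  have hL := legLead_pos n
  have h := (hasSum_legQ2'_shift n hx).mul_left (x ^ (n + 2))
  have h1 := (hasSum_nat_add_iff' 1).mpr h
  simp only [Finset.sum_range_one, zero_add] at h1
  have e0 : x ^ (n + 2) * (-(1 / 2) * ((((n : ℕ) : ℝ) + 1) / x ^ (n + 2)) * ∫ t in (-1 : ℝ)..1, t ^ n * legP n t)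
      = -(((n : ℝ) + 1) / ((2 * (n : ℝ) + 1) * legLead n)) := by
    rw [integral_pow_self_mul_legP]
    field_simp
  rw [e0] at h1
  have hgeom := (hasSum_succ_mul_inv_pow hx).mul_left ((n : ℝ) + 2)
  -- the tail terms are `≤ 0` and `≥ −(n + 2)(j + 1) x^{−(j+1)}`
  have hterm_ge : ∀ j : ℕ, -(((n : ℝ) + 2) * (((j : ℝ) + 1) / x ^ (j + 1)))
      ≤ x ^ (n + 2) * (-(1 / 2) * ((((j + 1 + n : ℕ) : ℝ) + 1) / x ^ (j + 1 + n + 2))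
        * ∫ t in (-1 : ℝ)..1, t ^ (j + 1 + n) * legP n t) := by
    intro j
    have hb : |∫ t in (-1 : ℝ)..1, t ^ (j + 1 + n) * legP n t| ≤ 2 := by
      have := intervalIntegral.norm_integral_le_of_norm_le_const (a := (-1 : ℝ)) (b := 1) (C := 1)
        (f := fun t => t ^ (j + 1 + n) * legP n t) fun t ht => by
          have ht' : t ∈ Icc (-1 : ℝ) 1 := by
            rw [Set.uIoc_of_le (by norm_num)] at ht
            exact Set.Ioc_subset_Icc_self ht
          have htabs : |t| ≤ 1 := abs_le.mpr ⟨ht'.1, ht'.2⟩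
          rw [Real.norm_eq_abs, abs_mul, abs_pow]
          calc |t| ^ (j + 1 + n) * |legP n t| ≤ 1 ^ (j + 1 + n) * 1 :=
                mul_le_mul (pow_le_pow_left₀ (abs_nonneg _) htabs _) (abs_legP_le_one n ht') (abs_nonneg _)
                  (by norm_num)
            _ = 1 := by rw [one_pow, mul_one]
      rw [Real.norm_eq_abs] at this
      norm_num at this
      linarith
    have hI := (abs_le.mp hb).2
    have hI0 : 0 ≤ ∫ t in (-1 : ℝ)..1, t ^ (j + 1 + n) * legP n t := integral_pow_mul_legP_nonneg (by omega)
    have hpow : x ^ (j + 1 + n + 2) = x ^ (n + 2) * x ^ (j + 1) := by ring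
    have hxn : 0 < x ^ (n + 2) := pow_pos hxpos _
    have hxj : 0 < x ^ (j + 1) := pow_pos hxpos _
    have hcoef : (((j + 1 + n : ℕ) : ℝ) + 1) ≤ ((n : ℝ) + 2) * ((j : ℝ) + 1) := by
      push_cast
      nlinarith [(Nat.cast_nonneg j : (0 : ℝ) ≤ j), (Nat.cast_nonneg n : (0 : ℝ) ≤ n)]
    rw [hpow]
    calc -(((n : ℝ) + 2) * (((j : ℝ) + 1) / x ^ (j + 1)))
        = -((1 / 2) * (((n : ℝ) + 2) * ((j : ℝ) + 1) / x ^ (j + 1)) * 2) := by ring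
      _ ≤ -((1 / 2) * ((((j + 1 + n : ℕ) : ℝ) + 1) / x ^ (j + 1))
            * ∫ t in (-1 : ℝ)..1, t ^ (j + 1 + n) * legP n t) := by
          rw [neg_le_neg_iff]
          gcongr
      _ = x ^ (n + 2) * (-(1 / 2) * ((((j + 1 + n : ℕ) : ℝ) + 1) / (x ^ (n + 2) * x ^ (j + 1)))
            * ∫ t in (-1 : ℝ)..1, t ^ (j + 1 + n) * legP n t) := by
          field_simp
  have hterm_le : ∀ j : ℕ, x ^ (n + 2) * (-(1 / 2) * ((((j + 1 + n : ℕ) : ℝ) + 1) / x ^ (j + 1 + n + 2))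
      * ∫ t in (-1 : ℝ)..1, t ^ (j + 1 + n) * legP n t) ≤ 0 := fun j => by
    have h0 := term_nonpos n hx (j + 1 + n)
    have : 0 ≤ x ^ (n + 2) := by positivity
    nlinarith [mul_nonneg this (neg_nonneg.mpr h0)]
  have htail_ge := hasSum_le hterm_ge hgeom.neg h1
  have htail_le := hasSum_le hterm_le h1 hasSum_zero
  rw [abs_le]
  constructor <;> linarith

/-- **THE ASYMPTOTIC OF `Q′_n`**: `x^{n+2} Q′_n(x) → −(n + 1)/((2n + 1) lc_n)` as `x → ∞`. -/
theorem tendsto_pow_mul_legQ2' (n : ℕ) :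
    Tendsto (fun x => x ^ (n + 2) * legQ2' n x) atTop (𝓝 (-(((n : ℝ) + 1) / ((2 * (n : ℝ) + 1) * legLead n)))) := by
  have hlim : Tendsto (fun x : ℝ => ((n : ℝ) + 2) * (x / (x - 1) ^ 2)) atTop (𝓝 (((n : ℝ) + 2) * 0)) := by
    refine Tendsto.const_mul _ ?_
    have e : ∀ᶠ x : ℝ in atTop, x / (x - 1) ^ 2 = (1 / (x - 1)) * (x / (x - 1)) := by
      filter_upwards [eventually_gt_atTop (1 : ℝ)] with x hx
      have : x - 1 ≠ 0 := by linarith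
      field_simp
    refine Tendsto.congr' (EventuallyEq.symm e) ?_
    have h1 : Tendsto (fun x : ℝ => 1 / (x - 1)) atTop (𝓝 0) := by
      have := tendsto_inv_atTop_zero.comp (tendsto_atTop_add_const_right atTop (-1 : ℝ) tendsto_id)
      refine this.congr fun x => ?_
      simp [Function.comp, one_div, sub_eq_add_neg]
    have h2 : Tendsto (fun x : ℝ => x / (x - 1)) atTop (𝓝 1) := by
      have e2 : ∀ᶠ x : ℝ in atTop, x / (x - 1) = 1 + 1 / (x - 1) := by
        filter_upwards [eventually_gt_atTop (1 : ℝ)] with x hx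
        have : x - 1 ≠ 0 := by linarith
        field_simp
        ring
      refine Tendsto.congr' (EventuallyEq.symm e2) ?_
      simpa using (tendsto_const_nhds (x := (1 : ℝ))).add h1
    simpa using h1.mul h2
  rw [mul_zero] at hlim
  rw [Metric.tendsto_atTop] at hlim ⊢
  intro ε hε
  obtain ⟨N, hN⟩ := hlim ε hε
  refine ⟨max N 2, fun x hx => ?_⟩
  have hx1 : 1 < x := lt_of_lt_of_le (by norm_num) (le_trans (le_max_right _ _) hx)
  have hxN := hN x (le_trans (le_max_left _ _) hx)
  rw [Real.dist_eq, sub_zero, abs_of_nonneg (by positivity)] at hxN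
  rw [Real.dist_eq, sub_neg_eq_add]
  exact lt_of_le_of_lt (abs_pow_mul_legQ2'_add_le n hx1) hxN

/-! ### The Wronskian -/

/-- **The Wronskian** `W_n = P_n Q′_n − P′_n Q_n`. -/
noncomputable def wronskian (n : ℕ) (x : ℝ) : ℝ := legP n x * legQ2' n x - legQ n x * legQ2 n x

/-- `W′_n = P_n Q″_n − P″_n Q_n` on `(1, ∞)`. -/
theorem hasDerivAt_wronskian (n : ℕ) {x : ℝ} (hx : 1 < x) :
    HasDerivAt (wronskian n) (legP n x * legQ2'' n x - legR n x * legQ2 n x) x := by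
  have h := ((hasDerivAt_legP n x).mul (hasDerivAt_legQ2' n hx)).sub ((hasDerivAt_legQ n x).mul (hasDerivAt_legQ2 n hx))
  refine h.congr_deriv ?_
  ring

/-- **`((1 − x²) W_n)′ = 0` on `(1, ∞)`** (the two Legendre equations). -/
theorem hasDerivAt_one_sub_sq_mul_wronskian (n : ℕ) {x : ℝ} (hx : 1 < x) :
    HasDerivAt (fun x => (1 - x ^ 2) * wronskian n x) 0 x := by
  have h := ((hasDerivAt_const x (1 : ℝ)).sub (hasDerivAt_pow 2 x)).mul (hasDerivAt_wronskian n hx)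
  refine h.congr_deriv ?_
  have hP := legendre_ode n x
  have hQ := legendre_ode_legQ2 n hx
  simp only [wronskian, Pi.sub_apply]
  push_cast
  linear_combination (legP n x) * hQ + (legQ2 n x) * hP

/-- **`(1 − x²) W_n` is constant on `(1, ∞)`.** -/
theorem one_sub_sq_mul_wronskian_eq (n : ℕ) {x y : ℝ} (hx : 1 < x) (hy : 1 < y) :
    (1 - x ^ 2) * wronskian n x = (1 - y ^ 2) * wronskian n y := by
  refine IsOpen.is_const_of_deriv_eq_zero isOpen_Ioi isPreconnected_Ioi
    (fun z hz => (hasDerivAt_one_sub_sq_mul_wronskian n hz.out).differentiableAt.differentiableWithinAt)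
    (fun z hz => (hasDerivAt_one_sub_sq_mul_wronskian n hz.out).deriv) hx hy

/-! ### The constant: the limit at `+∞` -/

/-- `P_n(x)/xⁿ → lc_n`. -/
theorem tendsto_legP_div_pow (n : ℕ) : Tendsto (fun x => legP n x / x ^ n) atTop (𝓝 (legLead n)) := by
  have h := Polynomial.div_tendsto_atTop_leadingCoeff_div_of_degree_eq (P := legPoly n) (Q := (X : ℝ[X]) ^ n)
    (by rw [degree_X_pow, degree_eq_natDegree (legPoly_ne_zero n), natDegree_legPoly])
  rw [leadingCoeff_legPoly, leadingCoeff_X_pow, div_one] at h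
  refine h.congr fun x => ?_
  rw [eval_pow, eval_X, legP_eq_eval]

/-- `x P′_n(x)/xⁿ → n lc_n` (via `x P′_n = n P_n + P′_{n−1}`, row 378, and `deg P′_{n−1} < n`). -/
theorem tendsto_mul_legQ_div_pow (n : ℕ) :
    Tendsto (fun x => x * legQ n x / x ^ n) atTop (𝓝 ((n : ℝ) * legLead n)) := by
  rcases n with _ | m
  · simp [legQ]
  · have e : ∀ x : ℝ, x * legQ (m + 1) x / x ^ (m + 1)
        = ((m : ℝ) + 1) * (legP (m + 1) x / x ^ (m + 1)) + legQ m x / x ^ (m + 1) := fun x => by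
      have h := mul_legQ_succ_sub_legQ m x
      rw [show x * legQ (m + 1) x = ((m : ℝ) + 1) * legP (m + 1) x + legQ m x by linarith]
      ring
    simp_rw [e]
    have h1 := (tendsto_legP_div_pow (m + 1)).const_mul ((m : ℝ) + 1)
    have h2 : Tendsto (fun x : ℝ => legQ m x / x ^ (m + 1)) atTop (𝓝 0) := by
      have := Polynomial.div_tendsto_atTop_zero_of_degree_lt (P := derivative (legPoly m)) (Q := (X : ℝ[X]) ^ (m + 1))
        (by
          rw [degree_X_pow]
          calc (derivative (legPoly m)).degree ≤ ((derivative (legPoly m)).natDegree : WithBot ℕ) :=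
                degree_le_natDegree
            _ ≤ ((m - 1 : ℕ) : WithBot ℕ) := by
                exact_mod_cast (natDegree_derivative_le _).trans (by rw [natDegree_legPoly])
            _ < ((m + 1 : ℕ) : WithBot ℕ) := by exact_mod_cast (by omega : m - 1 < m + 1))
      refine this.congr fun x => ?_
      rw [eval_pow, eval_X, eval_derivative_legPoly]
    have := h1.add h2
    push_cast
    simpa using this

/-- `(1 − x²)/x² → −1`. -/
theorem tendsto_one_sub_sq_div_sq : Tendsto (fun x : ℝ => (1 - x ^ 2) / x ^ 2) atTop (𝓝 (-1)) := by
  have e : ∀ᶠ x : ℝ in atTop, (1 - x ^ 2) / x ^ 2 = 1 / x ^ 2 - 1 := by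
    filter_upwards [eventually_gt_atTop (0 : ℝ)] with x hx
    field_simp
  refine Tendsto.congr' (EventuallyEq.symm e) ?_
  have h : Tendsto (fun x : ℝ => 1 / x ^ 2) atTop (𝓝 0) := by
    have := tendsto_inv_atTop_zero.comp (tendsto_pow_atTop (α := ℝ) (by norm_num : (2 : ℕ) ≠ 0))
    refine this.congr fun x => ?_
    simp [Function.comp, one_div]
  simpa using h.sub (tendsto_const_nhds (x := (1 : ℝ)))

/-- **`(1 − x²) W_n(x) → 1` as `x → ∞`.** -/
theorem tendsto_one_sub_sq_mul_wronskian (n : ℕ) :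
    Tendsto (fun x => (1 - x ^ 2) * wronskian n x) atTop (𝓝 1) := by
  have hL := legLead_pos n
  set c := 1 / ((2 * (n : ℝ) + 1) * legLead n) with hc
  have e : ∀ᶠ x : ℝ in atTop, (1 - x ^ 2) * wronskian n x
      = (1 - x ^ 2) / x ^ 2 * ((legP n x / x ^ n) * (x ^ (n + 2) * legQ2' n x)
          - (x * legQ n x / x ^ n) * (x ^ (n + 1) * legQ2 n x)) := by
    filter_upwards [eventually_gt_atTop (0 : ℝ)] with x hx
    have hxn : x ^ n ≠ 0 := pow_ne_zero _ hx.ne'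
    simp only [wronskian]
    field_simp
    ring
  refine Tendsto.congr' (EventuallyEq.symm e) ?_
  have h := tendsto_one_sub_sq_div_sq.mul
    (((tendsto_legP_div_pow n).mul (tendsto_pow_mul_legQ2' n)).sub
      ((tendsto_mul_legQ_div_pow n).mul (tendsto_pow_mul_legQ2 n)))
  have hval : (-1 : ℝ) * (legLead n * -(((n : ℝ) + 1) / ((2 * (n : ℝ) + 1) * legLead n))
      - (n : ℝ) * legLead n * (1 / ((2 * (n : ℝ) + 1) * legLead n))) = 1 := by
    have hne : (2 * (n : ℝ) + 1) ≠ 0 := by positivity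
    field_simp
    ring
  rw [hval] at h
  exact h

/-- **THE WRONSKIAN**: `P_n(x) Q′_n(x) − P′_n(x) Q_n(x) = 1/(1 − x²)` for every `x > 1`. -/
theorem wronskian_eq (n : ℕ) {x : ℝ} (hx : 1 < x) : wronskian n x = 1 / (1 - x ^ 2) := by
  have hconst : ∀ y, 1 < y → (1 - y ^ 2) * wronskian n y = (1 - x ^ 2) * wronskian n x :=
    fun y hy => one_sub_sq_mul_wronskian_eq n hy hx
  have hlim := tendsto_one_sub_sq_mul_wronskian n
  have hev : (fun y => (1 - y ^ 2) * wronskian n y) =ᶠ[atTop] fun _ => (1 - x ^ 2) * wronskian n x := by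
    filter_upwards [eventually_gt_atTop (1 : ℝ)] with y hy
    exact hconst y hy
  have h1 : (1 - x ^ 2) * wronskian n x = 1 :=
    (tendsto_nhds_unique (hlim.congr' hev) tendsto_const_nhds).symm
  have hne : (1 - x ^ 2) ≠ 0 := by nlinarith
  rw [eq_div_iff hne]
  linarith [h1]

/-- The Wronskian, spelled out: `P_n(x) Q′_n(x) − P′_n(x) Q_n(x) = 1/(1 − x²)` for `x > 1`. -/
theorem legP_mul_legQ2'_sub_legQ_mul_legQ2 (n : ℕ) {x : ℝ} (hx : 1 < x) :
    legP n x * legQ2' n x - legQ n x * legQ2 n x = 1 / (1 - x ^ 2) :=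
  wronskian_eq n hx

end Summit.Ventures.HodgeRepro2.T5SU11LegendreWronskian
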